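import Literature.NumberTheory.PAdicHodge.TateLogCyclotomicClass
import Mathlib.FieldTheory.Galois.Infinite
import HarnessLib

/-!
# Tate's normalised trace: `(K M)^γ = K n`, `R_n(K M) ⊆ K n`, and `γ − 1` on `ker R_n` at finite level
# (Tate 1967 §3.1–3.2)

Continuation of `TateNormalizedTrace` / `TateInvariantsBase` / `TateLogCyclotomicClass`. Notation as
there: `K₀ = PadicBase F p hp ≅ ℚ_p`, `F̄ = NormedAlgClosure F`, `G₀ = Gal(F̄/K₀)`, `K M = K₀(ζ_{p^M})`,
`γ = gen n` (acting on `ζ_{p^{n+1}}` by `ζ ↦ ζ^{1+p^n}`), `R_n = traceToLevel n M` on `K M`. THEOREMS ONLY;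
no named fact, no `sorry`.

* `PrincipalUnitPowers.exists_pow_modEq_of_modEq_one` — every residue `c ≡ 1 (mod p^j)` is a power of
  `1 + p^j a` modulo `p^M` (`p ∤ a`, `2 ≤ j ≤ M`): the cyclic group `(1 + p^j ℤ)/(1 + p^M ℤ)` is generated by
  any `1 + p^j a`, `p ∤ a` (counted with the tree's `sum_pow_mod_eq_sum`).
* `TateTrace.exists_pow_gen_smul_eq_of_smul_zeta_eq` — **`Gal(K M / K n) = ⟨γ⟩`**: an element of `G₀`
  fixing `ζ_{p^n}` acts on `K M` as a power of `γ`.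
* `TateTrace.mem_K_of_gen_smul_eq` — **`(K M)^γ = K n`**: an element of `K M` fixed by `γ` lies in `K n`
  (infinite Galois correspondence for `F̄/K₀`, Mathlib `InfiniteGalois.fixedField_fixingSubgroup`;
  `F̄/K₀` is Galois as an algebraic closure in characteristic `0`).
* `TateTrace.traceToLevel_mem_K` — **`R_n (K M) ⊆ K n`**; `traceToLevel_eq_self_of_mem_K` — `R_n` is the
  identity on `K n`; `traceToLevel_traceToLevel` — `R_n` is idempotent.
* `TateTrace.exists_gen_smul_sub_eq_of_traceToLevel_eq_zero` — **Tate's Prop. 7 at finite level**: `γ − 1`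
  is bijective on the finite-dimensional `K₀`-space `ker(R_n | K M)` (injective because `γ z = z` forces
  `z ∈ K n`, so `z = R_n z = 0`; hence surjective).

The passage to `X = \widehat{K_∞}` (Prop. 7 proper and the `H¹` criterion) is the sequel `TateTraceKernel`.

## References
* J. Tate, *p-divisible groups* (1967), §3.1 (the tower, `Gal(K_∞/K_n) ≅ ℤ_p`), §3.2 Prop. 7. [Tate1967]
* J.-M. Fontaine, Y. Ouyang, *Theory of p-adic Galois representations*, §3.1 (Prop. 3.16). [FontaineOuyang2022]
* J.-P. Serre, *A Course in Arithmetic*, Ch. II §3.2 (`1 + p^n ℤ_p`). [Serre1973]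
-/

noncomputable section

open ValuativeRel Field UniformSpace Filter Topology Finset

open scoped IntermediateField

namespace Literature.NumberTheory.PAdicHodge

namespace PrincipalUnitPowers

variable {p : ℕ} (hp : p.Prime)
include hp

/-- **`1 + p^j a` generates `(1 + p^j ℤ)/(1 + p^M ℤ)`** (`2 ≤ j ≤ M`, `p ∤ a`): every `c ≡ 1 (mod p^j)`
is congruent modulo `p^M` to a power `(1 + p^j a)^k`, `k < p^{M-j}` (the `p^{M-j}` residues of these
powers are pairwise distinct and all `≡ 1 (mod p^j)`, tree `sum_pow_mod_eq_sum`). [cite: Serre1973, Ch. II §3.2] -/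
theorem exists_pow_modEq_of_modEq_one {j M : ℕ} (hj : 2 ≤ j) (hjM : j ≤ M) {a : ℕ} (ha : ¬p ∣ a)
    {c : ℕ} (hc : c ≡ 1 [MOD p ^ j]) :
    ∃ k < p ^ (M - j), (1 + p ^ j * a) ^ k ≡ c [MOD p ^ M] := by
  classical
  have hpj : 0 < p ^ j := pow_pos hp.pos j
  have hpM : 0 < p ^ M := pow_pos hp.pos M
  have hNM : p ^ j * p ^ (M - j) = p ^ M := by rw [← pow_add]; congr 1; omega
  -- `c mod p^M = 1 + p^j t₀` with `t₀ < p^{M-j}`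
  set r := c % p ^ M with hr
  have hr1 : r % p ^ j = 1 := by
    rw [hr, Nat.mod_mod_of_dvd _ (pow_dvd_pow p hjM), hc]
    exact Nat.mod_eq_of_lt (Nat.one_lt_pow (by omega) hp.one_lt)
  have hrlt : r < p ^ M := Nat.mod_lt _ hpM
  have ht₀lt : r / p ^ j < p ^ (M - j) := by
    rw [Nat.div_lt_iff_lt_mul hpj, mul_comm, hNM]; exact hrlt
  have hrt : 1 + p ^ j * (r / p ^ j) = r := by
    have := Nat.div_add_mod r (p ^ j)
    rw [hr1] at this
    omega
  -- count with the indicator of `r`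
  have hsum := sum_pow_mod_eq_sum hp hj hjM ha (fun x => if x = r then (1 : ℕ) else 0)
  have hpos : 0 < ∑ t ∈ Finset.range (p ^ (M - j)), (if 1 + p ^ j * t = r then (1 : ℕ) else 0) := by
    refine Nat.pos_of_ne_zero fun h0 => ?_
    have := (Finset.sum_eq_zero_iff.mp h0) (r / p ^ j) (Finset.mem_range.mpr ht₀lt)
    rw [if_pos hrt] at this
    exact one_ne_zero this
  rw [← hsum] at hpos
  obtain ⟨k, hk, hk0⟩ := Finset.exists_ne_zero_of_sum_ne_zero hpos.ne'
  refine ⟨k, Finset.mem_range.mp hk, ?_⟩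
  by_cases hkr : (1 + p ^ j * a) ^ k % p ^ M = r
  · exact hkr
  · rw [if_neg hkr] at hk0; exact absurd rfl hk0

end PrincipalUnitPowers

open Literature.NumberTheory.GaloisRepresentations
open Literature.NumberTheory.GaloisRepresentations.IsNonarchimedeanLocalField
open CyclotomicTower

variable {F : Type} [Field F] [ValuativeRel F] [TopologicalSpace F] [IsNonarchimedeanLocalField F]
  [CharZero F] {p : ℕ} [Fact p.Prime] (hp : valuation F p < 1)

namespace TateTrace

/-! ### `Gal(K M / K n) = ⟨γ⟩` -/

/-- An element of `G₀` fixing `ζ_{p^n}` has cyclotomic character `≡ 1 (mod p^n)`, read on `ζ_{p^M}`: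
`g • ζ_{p^M} = ζ_{p^M}^c` with `c ≡ 1 (mod p^n)`. [cite: Tate1967, §3.1] -/
theorem exists_smul_zeta_eq_pow_of_smul_zeta_eq {n M : ℕ} (hnM : n ≤ M) {g : BaseGaloisGroup hp}
    (hg : g • zeta F p n = zeta F p n) :
    ∃ c : ℕ, c ≡ 1 [MOD p ^ n] ∧ g • zeta F p M = zeta F p M ^ c := by
  have hpP : p.Prime := Fact.out
  set z : ℤ_[p] := (BaseGaloisGroup.baseCyclotomicCharacter hp g : ℤ_[p]) with hz
  refine ⟨(PadicInt.toZModPow M z).val, ?_, ?_⟩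
  · have h1 : PadicInt.toZModPow n z = 1 := toZModPow_chi_eq_one hp hg
    have h2 : (ZMod.castHom (pow_dvd_pow p hnM) (ZMod (p ^ n))) (PadicInt.toZModPow M z) =
        PadicInt.toZModPow n z := by
      rw [← RingHom.comp_apply, PadicInt.zmod_cast_comp_toZModPow _ _ hnM]
    rw [h1, ZMod.castHom_apply, ZMod.cast_eq_val] at h2
    rw [← ZMod.natCast_eq_natCast_iff, Nat.cast_one]
    exact h2
  · exact BaseGaloisGroup.baseCyclotomicCharacter_spec hp g (zeta F p M) (zeta_spec F p M).pow_eq_one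

/-- **`Gal(K M / K n)` is generated by `γ = gen n`** (`2 ≤ n < M`): an element of `G₀` fixing
`ζ_{p^n}` acts on `K M` as some power `γ^k`. [cite: Tate1967, §3.1] -/
theorem exists_pow_gen_smul_eq_of_smul_zeta_eq {n M : ℕ} (hn : 2 ≤ n) (hM : n + 1 ≤ M)
    {g : BaseGaloisGroup hp} (hg : g • zeta F p n = zeta F p n) :
    ∃ k : ℕ, ∀ x ∈ K hp M, g • x = gen hp n ^ k • x := by
  have hpP : p.Prime := Fact.out
  obtain ⟨c, hc, hgc⟩ := exists_smul_zeta_eq_pow_of_smul_zeta_eq hp (M := M) (by omega) hg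
  obtain ⟨a, ha, hγ⟩ := exists_gen_smul_zeta hp (by omega : 1 ≤ n) hM
  obtain ⟨k, -, hk⟩ := PrincipalUnitPowers.exists_pow_modEq_of_modEq_one hpP (M := M) hn (by omega) ha hc
  refine ⟨k, fun x hx => smul_eq_smul_of_smul_zeta_eq hp ?_ hx⟩
  rw [hgc, pow_smul_eq_pow_pow hp hγ k]
  have hfin : IsOfFinOrder (zeta F p M) :=
    isOfFinOrder_iff_pow_eq_one.mpr ⟨p ^ M, pow_pos' M, (zeta_spec F p M).pow_eq_one⟩
  refine (hfin.pow_eq_pow_iff_modEq).mpr ?_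
  rw [← (zeta_spec F p M).eq_orderOf]
  exact hk.symm

/-- **`(K M)^γ = K n`**: an element of `K M` fixed by `γ = gen n` lies in `K n` (`2 ≤ n < M`). By the
infinite Galois correspondence for `F̄/K₀` it suffices that every `g ∈ Gal(F̄/K n)` fixes it, and such
`g` acts on `K M` as a power of `γ`. [cite: Tate1967, §3.1] [cite: FontaineOuyang2022, §3.1] -/
theorem mem_K_of_gen_smul_eq {n M : ℕ} (hn : 2 ≤ n) (hM : n + 1 ≤ M) {x : NormedAlgClosure F}
    (hx : x ∈ K hp M) (hγ : gen hp n • x = x) : x ∈ K hp n := by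
  haveI : IsGalois (PadicBase F p hp) (NormedAlgClosure F) := inferInstance
  rw [← InfiniteGalois.fixedField_fixingSubgroup (K hp n), IntermediateField.mem_fixedField_iff]
  intro g hg
  have hgζ : g • zeta F p n = zeta F p n := by
    have h := hg
    rw [IntermediateField.mem_fixingSubgroup_iff] at h
    exact h _ (zeta_mem_K hp n)
  obtain ⟨k, hk⟩ := exists_pow_gen_smul_eq_of_smul_zeta_eq hp hn hM hgζ
  have hγk : ∀ j : ℕ, gen hp n ^ j • x = x := by
    intro j
    induction j with
    | zero => rw [pow_zero, one_smul]
    | succ j ih => rw [pow_succ, mul_smul, hγ, ih]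
  change g • x = x
  rw [hk x hx, hγk]

/-! ### `R_n (K M) ⊆ K n`, `R_n` is the identity on `K n`, `R_n ∘ R_n = R_n` -/

/-- An average over a Galois orbit of a fixed element is the element. [folklore] -/
private theorem avg_eq_self_of_smul_eq' {δ : BaseGaloisGroup hp} {x : NormedAlgClosure F}
    (hx : δ • x = x) {N : ℕ} (hN : N ≠ 0) : avg hp δ N x = x := by
  have hk : ∀ k : ℕ, δ ^ k • x = x := by
    intro k
    induction k with
    | zero => rw [pow_zero, one_smul]
    | succ k ih => rw [pow_succ, mul_smul, hx, ih]
  have hN0 : (N : PadicBase F p hp) ≠ 0 := Nat.cast_ne_zero.mpr hN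
  rw [avg_def, Finset.sum_congr rfl fun k _ => hk k, Finset.sum_const, Finset.card_range,
    ← Nat.cast_smul_eq_nsmul (PadicBase F p hp), smul_smul, inv_mul_cancel₀ hN0, one_smul]

/-- **`R_n x ∈ K n` for `x ∈ K M`** (`2 ≤ n < M`): `R_n x` lies in `K M` and is fixed by `γ`.
[cite: Tate1967, §3.1] [cite: FontaineOuyang2022, §3.1] -/
theorem traceToLevel_mem_K {n M : ℕ} (hn : 2 ≤ n) (hM : n + 1 ≤ M) {x : NormedAlgClosure F}
    (hx : x ∈ K hp M) : traceToLevel hp n M x ∈ K hp n := by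
  refine mem_K_of_gen_smul_eq hp hn hM ?_ (gen_smul_traceToLevel hp (by omega) hM hx)
  rw [traceToLevel_def, avg_def]
  exact IntermediateField.smul_mem _ (sum_mem fun k _ => smul_mem_K hp _ hx)

/-- **`R_n` is the identity on `K n`**: `R_n x = x` for `x ∈ K n` (`γ` fixes `K n` pointwise).
[cite: Tate1967, §3.1] -/
theorem traceToLevel_eq_self_of_mem_K {n M : ℕ} (hn : 1 ≤ n) {x : NormedAlgClosure F}
    (hx : x ∈ K hp n) : traceToLevel hp n M x = x := by
  have hfix : gen hp n • x = x := by
    have h := gen_smul_zeta_self hp hn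
    have h1 : gen hp n • zeta F p n = (1 : BaseGaloisGroup hp) • zeta F p n := by rw [h, one_smul]
    have := smul_eq_smul_of_smul_zeta_eq hp h1 hx
    rwa [one_smul] at this
  rw [traceToLevel_def]
  exact avg_eq_self_of_smul_eq' hp hfix (pow_pos' _).ne'

/-- **`R_n` is idempotent on `K M`**: `R_n (R_n x) = R_n x`. [cite: Tate1967, §3.1] -/
theorem traceToLevel_traceToLevel {n M : ℕ} (hn : 2 ≤ n) (hM : n + 1 ≤ M) {x : NormedAlgClosure F}
    (hx : x ∈ K hp M) : traceToLevel hp n M (traceToLevel hp n M x) = traceToLevel hp n M x :=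
  traceToLevel_eq_self_of_mem_K hp (by omega) (traceToLevel_mem_K hp hn hM hx)

/-! ### Tate's Prop. 7 at finite level: `γ - 1` is bijective on `ker R_n ∩ K M` -/

/-- **`γ − 1` is invertible on `ker(R_n | K M)`** (`2 ≤ n < M`): for `y ∈ K M` with `R_n y = 0` there is
`z ∈ K M` with `R_n z = 0` and `γ z − z = y`. (On the finite-dimensional `K₀`-space `ker(R_n|K M)` the
`K₀`-linear map `γ − 1` is injective — `γ z = z` forces `z ∈ K n`, so `z = R_n z = 0` — hence surjective.)
[cite: Tate1967, §3.2 Prop. 7] [cite: FontaineOuyang2022, §3.1 Prop. 3.16] -/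
theorem exists_gen_smul_sub_eq_of_traceToLevel_eq_zero {n M : ℕ} (hn : 2 ≤ n) (hM : n + 1 ≤ M)
    {y : NormedAlgClosure F} (hy : y ∈ K hp M) (hy0 : traceToLevel hp n M y = 0) :
    ∃ z ∈ K hp M, traceToLevel hp n M z = 0 ∧ gen hp n • z - z = y := by
  set K₀ := PadicBase F p hp
  haveI : FiniteDimensional K₀ (K hp M) :=
    IntermediateField.adjoin.finiteDimensional (Algebra.IsIntegral.isIntegral (zeta F p M))
  -- `R_n` and `γ` as `K₀`-linear endomorphisms of `K M`
  let trL : K hp M →ₗ[K₀] K hp M :=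
    { toFun := fun z => ⟨traceToLevel hp n M z, by
        rw [traceToLevel_def, avg_def]
        exact IntermediateField.smul_mem _ (sum_mem fun k _ => smul_mem_K hp _ z.2)⟩
      map_add' := fun z w => Subtype.ext (by
        simp only [IntermediateField.coe_add]; exact traceToLevel_add hp n M z w)
      map_smul' := fun c z => Subtype.ext (by
        simp only [IntermediateField.coe_smul, RingHom.id_apply]; exact traceToLevel_smul hp n M c z) }
  let γL : K hp M →ₗ[K₀] K hp M :=
    { toFun := fun z => ⟨gen hp n • (z : NormedAlgClosure F), smul_mem_K hp _ z.2⟩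
      map_add' := fun z w => Subtype.ext (by
        simp only [IntermediateField.coe_add]; exact smul_add _ _ _)
      map_smul' := fun c z => Subtype.ext (by
        simp only [IntermediateField.coe_smul, RingHom.id_apply]; exact smul_comm _ _ _) }
  have htrL : ∀ z : K hp M, ((trL z : K hp M) : NormedAlgClosure F) = traceToLevel hp n M z := fun _ => rfl
  have hγL : ∀ z : K hp M, ((γL z : K hp M) : NormedAlgClosure F) = gen hp n • (z : NormedAlgClosure F) :=
    fun _ => rfl
  -- `T = γ - 1` preserves `V = ker R_n`
  let T₀ : K hp M →ₗ[K₀] K hp M := γL - LinearMap.id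
  have hT₀ : ∀ z : K hp M, ((T₀ z : K hp M) : NormedAlgClosure F) =
      gen hp n • (z : NormedAlgClosure F) - z := fun _ => rfl
  let V : Submodule K₀ (K hp M) := LinearMap.ker trL
  have hmemV : ∀ z : K hp M, z ∈ V ↔ traceToLevel hp n M z = 0 := by
    intro z
    rw [LinearMap.mem_ker]
    constructor
    · intro h; rw [← htrL, h]; rfl
    · intro h; exact Subtype.ext h
  have hV : ∀ z ∈ V, T₀ z ∈ V := by
    intro z hz
    rw [hmemV] at hz ⊢
    rw [hT₀, traceToLevel_sub, ← gen_smul_traceToLevel_eq, hz, smul_zero, sub_zero]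
  let T : V →ₗ[K₀] V := T₀.restrict hV
  have hT : ∀ w : V, (((T w : V) : K hp M) : NormedAlgClosure F) =
      gen hp n • ((w : K hp M) : NormedAlgClosure F) - (w : K hp M) := fun _ => rfl
  -- `T` is injective
  have hTinj : Function.Injective T := by
    intro w₁ w₂ h
    have h1 : gen hp n • (((w₁ - w₂ : V) : K hp M) : NormedAlgClosure F) =
        (((w₁ - w₂ : V) : K hp M) : NormedAlgClosure F) := by
      have := congrArg (fun w : V => (((w : V) : K hp M) : NormedAlgClosure F)) (show T (w₁ - w₂) = 0 by
        rw [map_sub, h, sub_self])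
      simp only [hT] at this
      exact sub_eq_zero.mp this
    have h3 : (((w₁ - w₂ : V) : K hp M) : NormedAlgClosure F) ∈ K hp n :=
      mem_K_of_gen_smul_eq hp hn hM ((w₁ - w₂ : V) : K hp M).2 h1
    have h4 := traceToLevel_eq_self_of_mem_K hp (M := M) (by omega) h3
    have h5 : traceToLevel hp n M (((w₁ - w₂ : V) : K hp M) : NormedAlgClosure F) = 0 :=
      (hmemV _).mp (w₁ - w₂).2
    rw [h5] at h4
    have h6 : w₁ - w₂ = 0 := by
      apply Subtype.ext; apply Subtype.ext
      exact h4.symm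
    exact sub_eq_zero.mp h6
  -- hence surjective
  have hTsurj : Function.Surjective T := LinearMap.surjective_of_injective hTinj
  have hyV : (⟨y, hy⟩ : K hp M) ∈ V := (hmemV _).mpr hy0
  obtain ⟨z, hz⟩ := hTsurj ⟨⟨y, hy⟩, hyV⟩
  refine ⟨((z : K hp M) : NormedAlgClosure F), (z : K hp M).2, (hmemV _).mp z.2, ?_⟩
  have := congrArg (fun w : V => (((w : V) : K hp M) : NormedAlgClosure F)) hz
  simp only [hT] at this
  exact this

end TateTrace

end Literature.NumberTheory.PAdicHodge

end
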